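/-
Copyright: cell `pub-ymgap` (HUMAN RULING D-0062), Track A of `YM-PLAN.md`, DAG node N20 (= NE7b); R134 acceleration seat
`pub-ymgap-dag-n20-c` (strategy s1, generation 6), module 37.  Released under the licence of the surrounding project.
-/
import Summits.QuantumFields.YangMills.Theorems.BalabanUVNodesN20LCSLabelTowerAtResidualOfRecord
import HarnessLib

/-!
# YM-DAG node N20 (= NE7b), strategy s1, module 37: CUTOFF PADDING OF A HISTORY TOWER (generic `Tower.pad`, the zero step map) and the END record's
# tower-side rows `hβ` ∕ `hp₀` ∕ `hstep` ∕ `hunit` ∕ mass for Bałaban's label tower at the residual of record PADDED AT ITS OWN CUTOFF, and (generic `Tower.reindex`)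
# THE ONE-CHOICE-TYPE CUTOFF FAMILY `labelTowerFam : (K : ℕ) → Tower LabelPatFam (cfgOfRecord F N K) bddMeas` — the END records' binder shape (g5's (t5))

Track A of `YM-PLAN.md` (cell `pub-ymgap`, HUMAN RULING D-0062), node **N20** = spine estimate NE7b (`T4WeightBudget.RelWeightBound` — NOT PRINTED,
NOT PROVED).  Seat `pub-ymgap-dag-n20-c` (R134, s1), generation 6, module 37 (after 34–36).  Definition lane: bookkeeping `def`s (`zeroHom`, `pad`, `reindex`,
`emptyLabel`, `runAt`, `LabelPatFam`, `readAt`, `labelTowerFam`, `p₀Fam`) + kernel theorems; 0 `sorry`, standard axioms; no `instance`, no notation; COUNT-NEUTRAL; `--supports` the K3⁗ item.  Nothing of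
Bałaban's is asserted.

WHY.  The END record `Support/B16HistoryTowerExtractionStepDataLWR` (and `…EndDataLWL`) indexes a run's step maps by ALL levels `j : ℕ` and DISPLAYS the padding
past the cutoff as the row `hβ : ∀ K ≥ K₀, ∀ j ≥ K, ((T K).op j g p).T (fun _ => 1) x = 0` («past the cutoff the step maps kill the unit — the natural padding of
a `K`-step run», J4.2), next to the small-field choice `p₀ K j` on every branch (`hp₀`).  Module 27's `labelTowerOfRecord` performs a T-step at EVERY level
`j`; g5's HANDOFF (t5) located the padded edition as owed.  THIS FILE supplies the generic constructions (`pad`, `reindex`), the rows at one cutoff, and (§5) the single-choice-type family over all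
cutoffs in the END records' shape — g5's located (t5) in full; the reading-side rows stay the planners' (module 36 §2 is the interface).

WHAT.
* §1 `zeroHom 𝒢X 𝒢Y` — the zero map as a `RelLinPosHom` (`zeroHom_apply`).
* §2 **`pad T K`** — same branches, `T`'s step maps below `K`, `zeroHom` from `K` on; `pad_branch` (rfl), `pad_op_of_lt`, ★ `pad_op_apply_of_le` (THE `hβ` ROW),
  `pad_adm`, `pad_admS` (admissible histories ∕ pattern classes unchanged), `pad_eterm_of_le` (history terms unchanged up to the cutoff), `pad_eterm_of_lt`
  (zero beyond), `pointwiseExtraction_pad_iff` (any cutoff), `locCondStability_pad_iff` (cutoffs `≤ K`) — so every half ∕ class bound of modules 28–36 at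
  cutoff `K′ ≤ K` transfers verbatim to the padded tower.
* §3 generic `reindex T e s` (choices read through `e`, branches pushed along `s`): `reindex_branch`∕`reindex_op` (rfl), `reindex_eterm` (`eterm′ K h′ = eterm K (e ∘ h′)`),
  `sum_reindex_branch` (`e ∘ s = id`).
* §4 at the residual of record: `emptyLabel j = ⟨j, (∅, ∅, (∅, ∅))⟩` (the small-field choice «no new large field, no (3.3) cube, no large fluctuation»),
  `emptyLabel_mem_branch` (`hp₀`), ★ `labelTowerPad_op_one_eq_zero` (`hβ` for Bałaban's label tower padded at `K`), `hstep_labelTowerPad` (`j < K`),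
  `hunit_labelTowerPad`, `integral_dens_labelTowerPad` (`∫ dens ρ₀ K′ dμ_{K′} = ∫ ρ₀ dU₀` for `K′ ≤ K` — the `H2A` shape survives the padding).
* §5 ★ g5's (t5) IN FULL — THE CUTOFF FAMILY WITH ONE CHOICE TYPE: `runAt p K = ⟨K, p.m, p.g0⟩`, `LabelPatFam = Σ K, LabelPat (runAt p K)`, `readAt K` (retraction of
  `Sigma.mk K`, `readAt_mk`), **`labelTowerFam K := pad (reindex (labelTowerOfRecord … (runAt p K) … ζ₃₁₆) (readAt K) (Sigma.mk K)) K`** — the END records' shape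
  `T : (K : ℕ) → Tower P (X K) (𝒢 K)` with `X K j = cfgOfRecord F N K j`; rows `p₀Fam_mem_branch` (`hp₀`), ★ `labelTowerFam_op_one_eq_zero` (`hβ`), `hstep_labelTowerFam`,
  `hunit_labelTowerFam`, `eterm_labelTowerFam_of_le` (history terms up to the cutoff = the run's, read through `readAt K`), ★ `integral_dens_labelTowerFam`
  (the `H2A` shape for the family: `∫ dens ρ₀ K′ dμ_{K′} = ∫ ρ₀ dU₀` on the torus `F.P K`, `K′ ≤ K`).

HONEST FRAMING.  Bookkeeping ([folklore]); no analysis; the END record's reading-side (`𝒮`, key patterns, `hν0` …) and print-side fields, `hreg`, «LCS-j» untouched;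
the family's cutoff index `K` is the torus index of `F.P K` AND the number of performed steps, as in the END records.
NE7b NOT PRINTED ∕ NOT PROVED; (α)-instance 0∕1; N20 NOT discharged; typed 28∕28, discharged count untouched; one finite four-torus at fixed `ε` — NOT ℝ⁴,
NOT infinite volume, NOT OS, NOT a mass gap, NOT Clay.

References (LOCATORS): T. Bałaban, CMP 122 (1989) 355–392 [Balaban1989LargeFieldII] ((1.71)–(1.72) pp. 378–379, (1.79) p. 383: the `K`-step run);
CMP 119 (1988) 243–285 [Balaban1988Convergent] ((3.2) p. 265: the empty label).
-/

set_option autoImplicit false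

noncomputable section

namespace Summit.QuantumFields.YangMills.BalabanUVNodes.N20LCSLabelTowerPadded

open MeasureTheory
open Summit.QuantumFields.BalabanUV.T4Continuum.B16HistoryIndexedRepr (GoodClass)
open Summit.QuantumFields.BalabanUV.T4Continuum.B16HistoryReprChain
open Summit.QuantumFields.BalabanUV.T4Continuum.NE7b.PrefixExtraction (admS mem_admS_succ)
open Summit.QuantumFields.BalabanUV.T4Continuum.NE7b.LocalConditionalStability (LocCondStability PointwiseExtraction)


/-! ## §1 The zero step map -/

section Zero

variable {X Y : Type} (𝒢X : GoodClass X) (𝒢Y : GoodClass Y)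

/-- **THE ZERO MAP between two levels** (kills every function): a positive additive map of good classes. [folklore] -/
def zeroHom : RelLinPosHom 𝒢X 𝒢Y where
  T _ _ := 0
  map_good _ := 𝒢Y.const 0
  mono _ _ _ _ := le_rfl
  add _ _ _ := (add_zero 0).symm
  smul _ c _ := (mul_zero c).symm

/-- The zero map sends every function to `0`. [folklore] -/
@[simp] theorem zeroHom_apply (f : X → ℝ) (y : Y) : (zeroHom 𝒢X 𝒢Y).T f y = 0 := rfl

end Zero

/-! ## §2 The cutoff-padded tower and what it preserves -/

section Pad

variable {P : Type} {C : ℕ → Type} {𝒢 : (j : ℕ) → GoodClass (C j)} (T : Tower P C 𝒢) (K : ℕ)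

/-- **THE CUTOFF-PADDED TOWER**: the same branches; the step maps of `T` below the cutoff `K` and the ZERO map from level `K` on — the natural
padding of a `K`-step run as an `ℕ`-indexed tower (the END record's display `hβ`). [folklore] -/
def pad : Tower P C 𝒢 where
  branch := T.branch
  op j h q := if j < K then T.op j h q else zeroHom (𝒢 j) (𝒢 (j + 1))

/-- The padded tower has the same branches. [folklore] -/
@[simp] theorem pad_branch : (pad T K).branch = T.branch := rfl

/-- Below the cutoff the padded tower's step maps are `T`'s. [folklore] -/
theorem pad_op_of_lt {j : ℕ} (hj : j < K) (h : Fin j → P) (q : P) : (pad T K).op j h q = T.op j h q := by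
  simp [pad, hj]

/-- **`hβ`**: from the cutoff on, the padded tower's step maps kill every function (in particular the unit). [folklore] -/
theorem pad_op_apply_of_le {j : ℕ} (hj : K ≤ j) (h : Fin j → P) (q : P) (f : C j → ℝ) (x : C (j + 1)) :
    ((pad T K).op j h q).T f x = 0 := by
  simp [pad, Nat.not_lt.2 hj]

/-- The admissible histories are unchanged by padding. [folklore] -/
theorem pad_adm : ∀ K', (pad T K).adm K' = T.adm K'
  | 0 => rfl
  | K' + 1 => by
      ext h
      rw [Tower.mem_adm_succ, Tower.mem_adm_succ, pad_adm K', pad_branch]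

/-- The pattern classes are unchanged by padding. [folklore] -/
theorem pad_admS [DecidableEq P] (S : (j : ℕ) → (Fin j → P) → Finset P) : ∀ K', admS (pad T K) S K' = admS T S K'
  | 0 => rfl
  | K' + 1 => by
      ext h
      rw [mem_admS_succ (pad T K) S, mem_admS_succ T S, pad_admS S K']
      rfl

/-- Up to the cutoff the history terms are unchanged by padding. [folklore] -/
theorem pad_eterm_of_le (ρ₀ : C 0 → ℝ) : ∀ j, j ≤ K → ∀ h : Fin j → P, (pad T K).eterm ρ₀ j h = T.eterm ρ₀ j h
  | 0, _, _ => rfl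
  | j + 1, hj, h => by
      show ((pad T K).op j (Fin.init h) (h (Fin.last j))).T ((pad T K).eterm ρ₀ j (Fin.init h)) =
        (T.op j (Fin.init h) (h (Fin.last j))).T (T.eterm ρ₀ j (Fin.init h))
      rw [pad_eterm_of_le ρ₀ j (Nat.le_of_succ_le hj) (Fin.init h), pad_op_of_lt T K (Nat.lt_of_succ_le hj)]

/-- Past the cutoff every history term vanishes. [folklore] -/
theorem pad_eterm_of_lt (ρ₀ : C 0 → ℝ) {j : ℕ} (hj : K < j) (h : Fin j → P) (x : C j) : (pad T K).eterm ρ₀ j h x = 0 := by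
  obtain ⟨j, rfl⟩ : ∃ j', j = j' + 1 := ⟨j - 1, by omega⟩
  exact pad_op_apply_of_le T K (Nat.le_of_lt_succ hj) _ _ _ x

/-- Pointwise extraction is unchanged by padding (it reads branches and pattern classes only). [folklore] -/
theorem pointwiseExtraction_pad_iff [DecidableEq P] (S : (j : ℕ) → (Fin j → P) → Finset P) (K' : ℕ)
    (χ : (j : ℕ) → (Fin j → P) → P → C j → ℝ) (M : (j : ℕ) → (Fin j → P) → C j → ℝ) (a : (j : ℕ) → (Fin j → P) → ℝ) :
    PointwiseExtraction (pad T K) S K' χ M a ↔ PointwiseExtraction T S K' χ M a := by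
  unfold PointwiseExtraction
  simp only [pad_admS, pad_branch]

/-- Local conditional stability up to the cutoff is unchanged by padding. [folklore] -/
theorem locCondStability_pad_iff [DecidableEq P] [∀ j, MeasurableSpace (C j)] (S : (j : ℕ) → (Fin j → P) → Finset P) {K' : ℕ}
    (hK : K' ≤ K) (μ : (j : ℕ) → Measure (C j)) (ρ₀ : C 0 → ℝ) (M : (j : ℕ) → (Fin j → P) → C j → ℝ)
    (b : (j : ℕ) → (Fin j → P) → ℝ) :
    LocCondStability (pad T K) S K' μ ρ₀ M b ↔ LocCondStability T S K' μ ρ₀ M b := by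
  unfold LocCondStability
  refine forall₂_congr fun j g => imp_congr_right fun hj => ?_
  rw [pad_admS T K S j, pad_eterm_of_le T K ρ₀ j (hj.le.trans hK) g]

end Pad


/-! ## §3 Reindexing the choices along a retraction `e ∘ s = id`: one choice type for a whole family of towers -/

section Reindex

variable {P P' : Type} {C : ℕ → Type} {𝒢 : (j : ℕ) → GoodClass (C j)} (T : Tower P C 𝒢) (e : P' → P) (s : P ↪ P')

/-- **THE REINDEXED TOWER**: choices read through `e : P′ → P`, branches pushed forward along the embedding `s : P ↪ P′` (a retraction pair `e ∘ s = id` in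
the applications): `branch′ j h′ = (branch j (e ∘ h′)).map s`, `op′ j h′ q′ = op j (e ∘ h′) (e q′)`. [folklore] -/
def reindex : Tower P' C 𝒢 where
  branch j h := (T.branch j (e ∘ h)).map s
  op j h q := T.op j (e ∘ h) (e q)

/-- The branches of the reindexed tower (rfl). [folklore] -/
theorem reindex_branch (j : ℕ) (h : Fin j → P') : (reindex T e s).branch j h = (T.branch j (e ∘ h)).map s := rfl

/-- The step maps of the reindexed tower (rfl). [folklore] -/
theorem reindex_op (j : ℕ) (h : Fin j → P') (q : P') : (reindex T e s).op j h q = T.op j (e ∘ h) (e q) := rfl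

/-- **THE HISTORY TERMS OF THE REINDEXED TOWER ARE THOSE OF THE READ HISTORIES**: `eterm′ K h′ = eterm K (e ∘ h′)`. [folklore] -/
theorem reindex_eterm (ρ₀ : C 0 → ℝ) : ∀ (K : ℕ) (h : Fin K → P'), (reindex T e s).eterm ρ₀ K h = T.eterm ρ₀ K (e ∘ h)
  | 0, _ => rfl
  | K + 1, h => by
      show (T.op K (e ∘ Fin.init h) (e (h (Fin.last K)))).T ((reindex T e s).eterm ρ₀ K (Fin.init h)) =
        (T.op K (Fin.init (e ∘ h)) ((e ∘ h) (Fin.last K))).T (T.eterm ρ₀ K (Fin.init (e ∘ h)))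
      rw [reindex_eterm ρ₀ K (Fin.init h)]
      rfl

/-- Sums over a reindexed branch of a function read through `e` are the sums over the original branch, when `e ∘ s = id`. [folklore] -/
theorem sum_reindex_branch (he : ∀ q, e (s q) = q) (j : ℕ) (h : Fin j → P') (φ : P → ℝ) :
    ∑ q' ∈ (reindex T e s).branch j h, φ (e q') = ∑ q ∈ T.branch j (e ∘ h), φ q := by
  rw [reindex_branch, Finset.sum_map]
  exact Finset.sum_congr rfl fun q _ => by simp [he]

end Reindex

/-! ## §4 Bałaban's label tower at the residual of record PADDED AT A CUTOFF `K`: the END record's tower-side rows at one cutoff -/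

section Record

open Literature.MathematicalPhysics.QuantumFieldTheory.Balaban1983to89
open Literature.MathematicalPhysics.QuantumFieldTheory.Balaban1983to89.T4Continuum
open Literature.MathematicalPhysics.QuantumFieldTheory.Balaban1983to89.Node00
open Summit.QuantumFields.YangMills.BalabanUVNodes.N20LCSLabelTower
open Summit.QuantumFields.YangMills.BalabanUVNodes.N20LCSLabelTowerAtResidualOfRecord

variable (F : T4Family) (N : ℕ) [NeZero N] (ν : Stage7Numerics) (M : ℕ) (p : B12.RunParams) (g : ℕ → ℝ) (A₁ : ℝ)

/-- **THE SMALL-FIELD CHOICE** at every level: the EMPTY label `(P, Q, R, S) = (∅, ∅, ∅, ∅)` («no new large field, no (3.3) cube, no large fluctuation»)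
— the END record's `p₀ K j`. [folklore] -/
def emptyLabel (j : ℕ) : LabelPat F ν p g := ⟨j, (∅, ∅, (∅, ∅))⟩

/-- **`hp₀`**: the small-field choice lies on every branch of the (padded) label tower. [folklore] -/
theorem emptyLabel_mem_branch (K j : ℕ) (h : Fin j → LabelPat F ν p g) :
    emptyLabel F ν p g j ∈ (pad (labelTowerOfRecord F N ν M p g A₁ (zeta316OfRecord F N ν M A₁)) K).branch j h := by
  rw [pad_branch, branch_eq]
  exact Finset.mem_map.2 ⟨(∅, ∅, (∅, ∅)), Finset.mem_univ _, rfl⟩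

/-- **`hβ` FOR BAŁABAN's LABEL TOWER PADDED AT THE CUTOFF `K`**: for `K ≤ j` every step map kills the unit. [folklore] -/
theorem labelTowerPad_op_one_eq_zero (K : ℕ) {j : ℕ} (hj : K ≤ j) (h : Fin j → LabelPat F ν p g) (q : LabelPat F ν p g)
    (x : cfgOfRecord F N p.K (j + 1)) :
    ((pad (labelTowerOfRecord F N ν M p g A₁ (zeta316OfRecord F N ν M A₁)) K).op j h q).T (fun _ => 1) x = 0 :=
  pad_op_apply_of_le _ K hj h q _ x

/-- **`hstep` BELOW THE CUTOFF** for the padded label tower at the residual of record, modulo nothing (module 34's `hstep_rec`). [folklore] -/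
theorem hstep_labelTowerPad (K : ℕ) {j : ℕ} (hj : j < K) (h : Fin j → LabelPat F ν p g) (q : LabelPat F ν p g)
    (f : cfgOfRecord F N p.K j → ℝ) (hf : (bddMeas (cfgOfRecord F N p.K j)).Gd f) :
    ∫ V', ((pad (labelTowerOfRecord F N ν M p g A₁ (zeta316OfRecord F N ν M A₁)) K).op j h q).T f V' ∂(lawOfRecord F N p.K (j + 1)) =
      ∫ U, labelChi F N ν M p g A₁ (zeta316OfRecord F N ν M A₁) j h q U * f U ∂(lawOfRecord F N p.K j) := by
  rw [pad_op_of_lt _ K hj]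
  exact hstep_rec F N ν M p g A₁ j h q f hf

/-- **`hunit`** for the padded label tower (branches unchanged; module 34's `hunit_rec`). [folklore] -/
theorem hunit_labelTowerPad (K j : ℕ) (h : Fin j → LabelPat F ν p g) (U : cfgOfRecord F N p.K j) :
    ∑ q ∈ (pad (labelTowerOfRecord F N ν M p g A₁ (zeta316OfRecord F N ν M A₁)) K).branch j h,
      labelChi F N ν M p g A₁ (zeta316OfRecord F N ν M A₁) j h q U = 1 := by
  rw [pad_branch]
  exact hunit_rec F N ν M p g A₁ j h U

/-- **THE LEVEL-`K′` DENSITY OF THE PADDED TOWER HAS THE MASS OF `ρ₀` up to the cutoff** (module 34's `integral_dens_rec`; the history terms are unchanged up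
to `K`). [folklore] -/
theorem integral_dens_labelTowerPad (K : ℕ) {ρ₀ : cfgOfRecord F N p.K 0 → ℝ} (hρ : (bddMeas (cfgOfRecord F N p.K 0)).Gd ρ₀) {K' : ℕ} (hK : K' ≤ K) :
    ∫ V, (pad (labelTowerOfRecord F N ν M p g A₁ (zeta316OfRecord F N ν M A₁)) K).dens ρ₀ K' V ∂(lawOfRecord F N p.K K') =
      ∫ U, ρ₀ U ∂(fieldMeasure (F.P p.K) 0 (SU N)) := by
  rw [← integral_dens_rec F N ν M p g A₁ hρ K']
  refine integral_congr_ae (ae_of_all _ fun V => ?_)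
  show ∑ h ∈ (pad _ K).adm K', _ = ∑ h ∈ Tower.adm _ K', _
  rw [pad_adm]
  exact Finset.sum_congr rfl fun h _ => by rw [pad_eterm_of_le _ K ρ₀ K' hK h]

end Record

/-! ## §5 THE CUTOFF FAMILY WITH ONE CHOICE TYPE (g5's (t5)): torus `F.P K`, run parameters `runAt p K`, choices `Σ K, LabelPat (runAt p K)`, padded at `K` -/

section Family

open Literature.MathematicalPhysics.QuantumFieldTheory.Balaban1983to89
open Literature.MathematicalPhysics.QuantumFieldTheory.Balaban1983to89.T4Continuum
open Literature.MathematicalPhysics.QuantumFieldTheory.Balaban1983to89.Node00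
open Summit.QuantumFields.YangMills.BalabanUVNodes.N20LCSLabelTower
open Summit.QuantumFields.YangMills.BalabanUVNodes.N20LCSLabelTowerAtResidualOfRecord

variable (F : T4Family) (N : ℕ) [NeZero N] (ν : Stage7Numerics) (M : ℕ) (p : B12.RunParams) (g : ℕ → ℝ) (A₁ : ℝ)

/-- The run parameters of the run with cutoff `K` (same `m`, `g0`; `(runAt p K).K = K` by `rfl`). [folklore] -/
abbrev runAt (K : ℕ) : B12.RunParams := ⟨K, p.m, p.g0⟩

/-- **ONE CHOICE TYPE FOR ALL CUTOFFS**: a label of some level of some run, `Σ K, LabelPat F ν (runAt p K) g`. [folklore] -/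
abbrev LabelPatFam : Type := Σ K, LabelPat F ν (runAt p K) g

open Classical in
/-- Reading a family choice as a choice of the run with cutoff `K` (a dummy empty label if it belongs to another run — never used on a branch). [folklore] -/
def readAt (K : ℕ) (q : LabelPatFam F ν p g) : LabelPat F ν (runAt p K) g :=
  if h : q.1 = K then h ▸ q.2 else ⟨0, (∅, ∅, (∅, ∅))⟩

/-- `readAt K` retracts the inclusion `Sigma.mk K`. [folklore] -/
theorem readAt_mk (K : ℕ) (q : LabelPat F ν (runAt p K) g) : readAt F ν p g K ⟨K, q⟩ = q := by
  simp [readAt]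

/-- ★ **THE CUTOFF FAMILY OF BAŁABAN's LABEL TOWERS AT THE RESIDUAL OF RECORD, ONE CHOICE TYPE, PADDED AT THE CUTOFF** — the shape
`T : (K : ℕ) → Tower P (X K) (𝒢 K)` of the END records (`X K j = cfgOfRecord F N K j`, `𝒢 K j = bddMeas`, `P = LabelPatFam`). [folklore] -/
def labelTowerFam (K : ℕ) : Tower (LabelPatFam F ν p g) (cfgOfRecord F N K) (fun j => bddMeas (cfgOfRecord F N K j)) :=
  pad (reindex (labelTowerOfRecord F N ν M (runAt p K) g A₁ (zeta316OfRecord F N ν M A₁)) (readAt F ν p g K)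
    (Function.Embedding.sigmaMk (β := fun K => LabelPat F ν (runAt p K) g) K)) K

/-- **THE FAMILY's SMALL-FIELD CHOICE** `p₀ K j`: the empty label of level `j` of the run with cutoff `K`. [folklore] -/
def p₀Fam (K j : ℕ) : LabelPatFam F ν p g := ⟨K, ⟨j, (∅, ∅, (∅, ∅))⟩⟩

/-- **`hp₀` for the family**: the small-field choice lies on every branch. [folklore] -/
theorem p₀Fam_mem_branch (K j : ℕ) (h : Fin j → LabelPatFam F ν p g) : p₀Fam F ν p g K j ∈ (labelTowerFam F N ν M p g A₁ K).branch j h := by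
  show p₀Fam F ν p g K j ∈ (pad (reindex _ _ _) K).branch j h
  rw [pad_branch, reindex_branch, branch_eq]
  exact Finset.mem_map.2 ⟨⟨j, (∅, ∅, (∅, ∅))⟩, Finset.mem_map.2 ⟨(∅, ∅, (∅, ∅)), Finset.mem_univ _, rfl⟩, rfl⟩

/-- ★ **`hβ` for the family**: past the cutoff every step map kills the unit. [folklore] -/
theorem labelTowerFam_op_one_eq_zero (K : ℕ) {j : ℕ} (hj : K ≤ j) (h : Fin j → LabelPatFam F ν p g) (q : LabelPatFam F ν p g)
    (x : cfgOfRecord F N K (j + 1)) : ((labelTowerFam F N ν M p g A₁ K).op j h q).T (fun _ => 1) x = 0 :=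
  pad_op_apply_of_le _ K hj h q _ x

/-- **`hstep` for the family below the cutoff**: `∫ (op j h q).T f dμ_{j+1} = ∫ labelChi j (readAt ∘ h) (readAt q) · f dμ_j` (module 34's `hstep_rec` for the run
with cutoff `K`, read through `readAt K`). [folklore] -/
theorem hstep_labelTowerFam (K : ℕ) {j : ℕ} (hj : j < K) (h : Fin j → LabelPatFam F ν p g) (q : LabelPatFam F ν p g)
    (f : cfgOfRecord F N K j → ℝ) (hf : (bddMeas (cfgOfRecord F N K j)).Gd f) :
    ∫ V', ((labelTowerFam F N ν M p g A₁ K).op j h q).T f V' ∂(lawOfRecord F N K (j + 1)) =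
      ∫ U, labelChi F N ν M (runAt p K) g A₁ (zeta316OfRecord F N ν M A₁) j (readAt F ν p g K ∘ h) (readAt F ν p g K q) U * f U
        ∂(lawOfRecord F N K j) := by
  show ∫ V', ((pad (reindex _ _ _) K).op j h q).T f V' ∂_ = _
  rw [pad_op_of_lt _ K hj, reindex_op]
  exact hstep_rec F N ν M (runAt p K) g A₁ j _ _ f hf

/-- **`hunit` for the family**: the step kernels over a branch sum to one. [folklore] -/
theorem hunit_labelTowerFam (K j : ℕ) (h : Fin j → LabelPatFam F ν p g) (U : cfgOfRecord F N K j) :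
    ∑ q ∈ (labelTowerFam F N ν M p g A₁ K).branch j h,
      labelChi F N ν M (runAt p K) g A₁ (zeta316OfRecord F N ν M A₁) j (readAt F ν p g K ∘ h) (readAt F ν p g K q) U = 1 := by
  show ∑ q ∈ (pad (reindex _ _ _) K).branch j h, _ = 1
  rw [pad_branch]
  exact (sum_reindex_branch _ _ _ (readAt_mk F ν p g K) j h
    (fun t => labelChi F N ν M (runAt p K) g A₁ (zeta316OfRecord F N ν M A₁) j (readAt F ν p g K ∘ h) t U)).trans
    (hunit_rec F N ν M (runAt p K) g A₁ j _ U)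

/-- **THE FAMILY's HISTORY TERMS UP TO THE CUTOFF ARE THE RUN's** (read through `readAt K`): so every half ∕ class bound ∕ identity of modules 34–36 at cutoff
`K′ ≤ K` holds for `labelTowerFam K` along the read histories. [folklore] -/
theorem eterm_labelTowerFam_of_le (K : ℕ) (ρ₀ : cfgOfRecord F N K 0 → ℝ) {j : ℕ} (hj : j ≤ K) (h : Fin j → LabelPatFam F ν p g) :
    (labelTowerFam F N ν M p g A₁ K).eterm ρ₀ j h =
      (labelTowerOfRecord F N ν M (runAt p K) g A₁ (zeta316OfRecord F N ν M A₁)).eterm ρ₀ j (readAt F ν p g K ∘ h) := by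
  show (pad (reindex _ _ _) K).eterm ρ₀ j h = _
  rw [pad_eterm_of_le _ K ρ₀ j hj]
  exact reindex_eterm _ _ _ ρ₀ j h

/-- ★ **THE END RECORD's `H2A` SHAPE FOR THE FAMILY**: the level-`K′` density of `labelTowerFam K` has the mass of `ρ₀` for every `K′ ≤ K` —
`∫ dens ρ₀ K′ dμ_{K′} = ∫ ρ₀ dU₀` on the torus `F.P K` (the generic telescoping `Tower.integral_dens_eq_of_lt` with the rows `hint` ∕ `hint′` ∕ `hpres` of the family,
each read through `readAt K` from module 34's letter-free rows). [folklore] -/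
theorem integral_dens_labelTowerFam (K : ℕ) {ρ₀ : cfgOfRecord F N K 0 → ℝ} (hρ : (bddMeas (cfgOfRecord F N K 0)).Gd ρ₀) {K' : ℕ} (hK : K' ≤ K) :
    ∫ V, (labelTowerFam F N ν M p g A₁ K).dens ρ₀ K' V ∂(lawOfRecord F N K K') = ∫ U, ρ₀ U ∂(fieldMeasure (F.P K) 0 (SU N)) := by
  set T := labelTowerOfRecord F N ν M (runAt p K) g A₁ (zeta316OfRecord F N ν M A₁) with hT
  rw [← lawOfRecord_zero F N K]
  refine (labelTowerFam F N ν M p g A₁ K).integral_dens_eq_of_lt (lawOfRecord F N K) ρ₀ K' ?_ ?_ ?_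
  · intro j h hj _
    rw [eterm_labelTowerFam_of_le F N ν M p g A₁ K ρ₀ (hj.le.trans hK) h]
    exact integrable_eterm F N ν M (runAt p K) g hρ j _
  · intro j h q hj _ _
    show Integrable (((pad (reindex T _ _) K).op j h q).T ((labelTowerFam F N ν M p g A₁ K).eterm ρ₀ j h)) _
    rw [pad_op_of_lt _ K (hj.trans_le hK), reindex_op, eterm_labelTowerFam_of_le F N ν M p g A₁ K ρ₀ (hj.le.trans hK) h]
    exact integrable_op_eterm F N ν M (runAt p K) g hρ j _ _
  · intro j h hj _
    rw [eterm_labelTowerFam_of_le F N ν M p g A₁ K ρ₀ (hj.le.trans hK) h]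
    have e : ∀ x, ∑ q ∈ (labelTowerFam F N ν M p g A₁ K).branch j h,
        ((labelTowerFam F N ν M p g A₁ K).op j h q).T (T.eterm ρ₀ j (readAt F ν p g K ∘ h)) x =
        ∑ t ∈ T.branch j (readAt F ν p g K ∘ h), (T.op j (readAt F ν p g K ∘ h) t).T (T.eterm ρ₀ j (readAt F ν p g K ∘ h)) x := by
      intro x
      show ∑ q ∈ (pad (reindex T _ _) K).branch j h, ((pad (reindex T _ _) K).op j h q).T _ x = _
      rw [pad_branch]
      refine (Finset.sum_congr rfl fun q _ => by rw [pad_op_of_lt _ K (hj.trans_le hK), reindex_op]).trans ?_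
      exact sum_reindex_branch T _ _ (readAt_mk F ν p g K) j h (fun t => (T.op j (readAt F ν p g K ∘ h) t).T (T.eterm ρ₀ j (readAt F ν p g K ∘ h)) x)
    rw [integral_congr_ae (ae_of_all _ e)]
    exact hpres_eterm_rec F N ν M (runAt p K) g A₁ hρ j _

end Family

end Summit.QuantumFields.YangMills.BalabanUVNodes.N20LCSLabelTowerPadded

end
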